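/-
COR-CM (cell pub-hodgecm2) — Δ2 BRIDGE, ADAPTER TRACK seat adapt-2 (the contragredient Ω-transport), Track T (own-crow PROPOSAL T; ω-side spec
mc-theta-3 HOME/INBOX l.12038 (T4a)–(T4c)): THE ω-SIDE CORE OF THE ANTILINEAR TRANSPORT.  The true form of «`(line i).Ω ≃ ω(μᶜ, −ε, χ⁻¹)`»
is CONJUGATE-LINEAR ([Liu2021, Lem. D.1 (2)]: conjugate = contragredient for these unitarisable modules): complex conjugation `C` of
finite-adelic Schwartz–Bruhat functions carries the Weil operators of the form `⟨·,·⟩_T` to those of `⟨·,·⟩_{−T}`.  The tree ALREADY holds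
the adelic statement (✔ `Weil1964/AdelicSchrodingerConj{,Cont}.lean`, mc-unitary-3: `adelicMpContConj F ι T : Mp_ψ(W_T)ᶜᵒⁿᵗ ≃*
Mp_ψ(W_{−T})ᶜᵒⁿᵗ`, `(g, M) ↦ (g, C M C)`, with `ω_{−T}(pᶜ) Ψ = C (ω_T(p) (C Ψ))`); this file draws the consequence for Weil's FINITE FACTOR
`finRepMp` (✔ `AdelicMetaplecticFinRep.lean`, mc-theta-2), the representation the dual-pair coinvariants `finPairRep ∕ weilCoinv ∕ SplitLine.Ω`
are built from:
* **`finRepMp_eq_conj_of_omega_eq`** — INTERTWINED form: for `s : H →* Mp_ψ(W_T)ᶜᵒⁿᵗ`, `s′ : H′ →* Mp_ψ(W_{T′})ᶜᵒⁿᵗ` fixing the archimedean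
  vectors and `ψ : H → H′` with `ω_{T′}(s′ (ψ h)) Ψ = C (ω_T(s h) (C Ψ))`, the finite factors satisfy **`ω_f(s′)(ψ h) f = C (ω_f(s)(h) (C f))`**
  (`C = finSBConj`, ✔ `AdelicSchrodingerConjCont`);
* the MODEL instance **`finRepMp_conj_apply`** at `T′ = −T`, `s′ = adelicMpContConj ∘ s`, `ψ = id` (archimedean-vector hypothesis transported by
  ✔ `coe_proj_adelicMpContConj`: `proj_adelicMpContConj_comp_apply_archVec`), and the semilinear-intertwiner reading `finSBConj_finRepMp`
  (`C (ω_f(s)(h) f) = ω_f(s̄)(h) (C f)` — the shape of prove-7's (T4c) binders `hV ∕ hW` for `TwistedCoinvSemilinear`).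
Proof: `ω(s h)(φ₀ ⊗ f) = φ₀ ⊗ ω_f(h) f` (`omega_map_tmul_finRepMp`), `C (φ ⊗ Φ_f) = φ̄ ⊗ Φ̄_f` (`piSchwartzBruhatConj_equiv_tmul`), uniqueness
of the finite factor (`finRepMp_unique` at `φ₀ = unitSchwartz`); no `rw` through Weil operators (the `−T` instances make `kabstract` time out
in `isDefEq`, cf. the note at ✔ `coe_proj_adelicMpContConj`).  NOT here (sequels, honest scope): the `≃ₛₗ[starRingEnd ℂ]` packaging of `C`
(Literature leaf `Weil1964/FinSchwartzBruhatConj.lean`, filed beside this one); the conj-transported PAIR splitting of the unitary dual pair at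
`(J_V, −J_W)` as a term and its `IsCompatible` (π-section by `coe_proj_adelicMpContConj`, rational values by ✔ `ratPointsThetaLiftCont_unique`).
THEOREMS ONLY; no definition, no named fact, no instance, no `variable` Prop; nothing restated.  HC_CM is NOT proved; «Δ2 BRIDGE CLOSED» is
NOT claimed; no pointer moves.
-/
import Literature.NumberTheory.Weil1964.AdelicSchrodingerConjCont
import Literature.NumberTheory.Weil1964.AdelicMetaplecticFinRep
import HarnessLib

set_option autoImplicit false

/-!
# `ω_f(s̄) = C ω_f(s) C`: complex conjugation and Weil's finite factor

* `unitSchwartz_ne_zero'`, `finRepMp_eq_conj_of_omega_eq`, `proj_adelicMpContConj_comp_apply_archVec`, `finRepMp_conj_apply`, `finSBConj_finRepMp`.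
-/

noncomputable section

open scoped TensorProduct ComplexConjugate Classical

namespace Summit.HodgeConjecture.CorCM.D2Bridge.AdapterWeil

open Literature.NumberTheory.Weil1964
open Literature.RepresentationTheory.HeisenbergGroup Literature.NumberTheory.Automorphic NumberField
  NumberField.mixedEmbedding IsDedekindDomain TensorProduct

variable {F : Type} [Field F] [NumberField F] {ι : Type} [Fintype ι]

/-- `φ₀ ≠ 0` for the fixed archimedean test function of `finPart` (`φ₀(0) = 1`). [folklore] -/
theorem unitSchwartz_ne_zero' : unitSchwartz F ι ≠ 0 := fun h => by
  have h1 : (unitSchwartz F ι) 0 = 1 := unitSchwartz_apply_zero (F := F) (ι := ι)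
  have h0 : (unitSchwartz F ι) 0 = 0 := by
    rw [h]
    rfl
  exact zero_ne_one (h0.symm.trans h1)

variable [DecidableEq ι] {T T' : Matrix ι ι (AdeleRing (𝓞 F) F)} {H H' : Type*} [Monoid H] [Monoid H']

/-- **INTERTWINED CONJUGATION LAW FOR WEIL'S FINITE FACTOR.**  Let `s : H →* Mp_ψ(W_T)ᶜᵒⁿᵗ` and `s′ : H′ →* Mp_ψ(W_{T′})ᶜᵒⁿᵗ` fix
the archimedean vectors (so their finite factors `ω_f(s)`, `ω_f(s′)` exist, ✔ `finRepMp`), and let `ψ : H → H′` INTERTWINE THE OPERATORS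
THROUGH COMPLEX CONJUGATION: `ω_{T′}(s′ (ψ h)) Ψ = C (ω_T(s h) (C Ψ))` for all `Ψ ∈ 𝒮(𝔸_F^ι)`.  Then the finite factors satisfy
`ω_f(s′)(ψ h) f = C (ω_f(s)(h) (C f))`: on `φ₀ ⊗ f`, `C (ω_T(s h)(φ̄₀ ⊗ f̄)) = C (φ̄₀ ⊗ ω_f(s)(h) f̄) = φ₀ ⊗ C (ω_f(s)(h) f̄)`, and the finite
factor is unique.  (At `T′ = −T`, `s′ = conj ∘ s`, `ψ = id` the hypothesis is ✔ `adelicMpCont.omega_adelicMpContConj_apply` — `finRepMp_conj_apply`;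
the intertwined form lets a consumer whose Gram matrix is only PROPOSITIONALLY `−T`, e.g. the dual pair at `(J_V, −J_W)`, plug in with one cast.)
[cite: Weil1964, Chap. III n° 37–38 p. 188–190] [cite: MoeglinVignerasWaldspurger1987, Chap. 2 II.1] [cite: Li1992, p. 181] -/
theorem finRepMp_eq_conj_of_omega_eq (hT : IsUnit T) (hT' : IsUnit T') (s : H →* adelicMpCont F ι T) (s' : H' →* adelicMpCont F ι T')
    (harch : ∀ (h : H) (a w : ι → mixedSpace F),
      (adelicMpCont.proj F ι T (s h)).1 (archVec F ι a, archVec F ι w) = (archVec F ι a, archVec F ι w))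
    (harch' : ∀ (h : H') (a w : ι → mixedSpace F),
      (adelicMpCont.proj F ι T' (s' h)).1 (archVec F ι a, archVec F ι w) = (archVec F ι a, archVec F ι w))
    (ψ : H → H')
    (hψ : ∀ (h : H) (Ψ : piSchwartzBruhat F ι),
      adelicMpCont.omega F ι T' (s' (ψ h)) Ψ = piSchwartzBruhatConj F ι (adelicMpCont.omega F ι T (s h) (piSchwartzBruhatConj F ι Ψ)))
    (h : H) (f : FinSB F ι) :
    finRepMp hT' s' harch' (ψ h) f = finSBConj (finRepMp hT s harch h (finSBConj f)) := by
  -- the `ℂ`-linear sandwich `B′ := C ω_f(s)(h) C`, built by hand (two antilinear maps compose to a linear one)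
  let B : FinSB F ι →ₗ[ℂ] FinSB F ι := finRepMp hT s harch h
  let B' : FinSB F ι →ₗ[ℂ] FinSB F ι :=
    { toFun := fun g => finSBConj (B (finSBConj g))
      map_add' := fun g g' => Subtype.ext (by
        change star ((B (finSBConj (g + g')) : FinSB F ι) : (ι → FiniteAdeleRing (𝓞 F) F) → ℂ) =
          star ((B (finSBConj g) : FinSB F ι) : (ι → FiniteAdeleRing (𝓞 F) F) → ℂ) +
            star ((B (finSBConj g') : FinSB F ι) : (ι → FiniteAdeleRing (𝓞 F) F) → ℂ)
        have hadd : finSBConj (g + g') = finSBConj g + finSBConj g' := Subtype.ext (star_add _ _)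
        rw [hadd, map_add, Submodule.coe_add, star_add])
      map_smul' := fun c g => Subtype.ext (by
        change star ((B (finSBConj (c • g)) : FinSB F ι) : (ι → FiniteAdeleRing (𝓞 F) F) → ℂ) =
          c • star ((B (finSBConj g) : FinSB F ι) : (ι → FiniteAdeleRing (𝓞 F) F) → ℂ)
        have hsmul : finSBConj (c • g) = (starRingEnd ℂ c) • finSBConj g := Subtype.ext (by
          change star (c • (g : (ι → FiniteAdeleRing (𝓞 F) F) → ℂ)) = (starRingEnd ℂ c) • star (g : (ι → FiniteAdeleRing (𝓞 F) F) → ℂ)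
          rw [star_smul, starRingEnd_apply])
        rw [hsmul, map_smul, Submodule.coe_smul, star_smul, starRingEnd_apply, star_star]) }
  -- (no `rw` through `ω`: `kabstract` would compare Weil operators in `isDefEq`; an explicit chain of `congrArg`s instead)
  have key : B' = finRepMp hT' s' harch' (ψ h) := by
    refine finRepMp_unique hT' s' harch' (ψ h) unitSchwartz_ne_zero' fun g => ?_
    have e1 := hψ h (piSchwartzBruhatEquiv F ι (unitSchwartz F ι ⊗ₜ g))
    have e2 := congrArg (fun x => piSchwartzBruhatConj F ι (adelicMpCont.omega F ι T (s h) x))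
      (piSchwartzBruhatConj_equiv_tmul F ι (unitSchwartz F ι) g)
    have e3 := congrArg (fun x => piSchwartzBruhatConj F ι x)
      (omega_map_tmul_finRepMp hT s harch h (schwartzConj (unitSchwartz F ι)) (finSBConj g))
    have e4 := piSchwartzBruhatConj_equiv_tmul F ι (schwartzConj (unitSchwartz F ι)) (finRepMp hT s harch h (finSBConj g))
    have e5 : piSchwartzBruhatEquiv F ι (schwartzConj (schwartzConj (unitSchwartz F ι)) ⊗ₜ
        finSBConj (finRepMp hT s harch h (finSBConj g))) = piSchwartzBruhatEquiv F ι (unitSchwartz F ι ⊗ₜ B' g) := by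
      rw [schwartzConj_schwartzConj]
      rfl
    exact e1.trans (e2.trans (e3.trans (e4.trans e5)))
  exact (LinearMap.congr_fun key f).symm

/-- **the conjugate splitting fixes the archimedean vectors when the splitting does** (`π(pᶜ) = π(p)` in `GL(W_𝔸)`,
✔ `coe_proj_adelicMpContConj`). [folklore] -/
theorem proj_adelicMpContConj_comp_apply_archVec (s : H →* adelicMpCont F ι T)
    (harch : ∀ (h : H) (a w : ι → mixedSpace F),
      (adelicMpCont.proj F ι T (s h)).1 (archVec F ι a, archVec F ι w) = (archVec F ι a, archVec F ι w))
    (h : H) (a w : ι → mixedSpace F) :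
    (adelicMpCont.proj F ι (-T) ((adelicMpContConj F ι T).toMonoidHom.comp s h)).1 (archVec F ι a, archVec F ι w) =
      (archVec F ι a, archVec F ι w) :=
  -- `(e.toMonoidHom.comp s) h = e (s h)` definitionally; `π(pᶜ) = π(p)` as automorphisms of `W_𝔸`; no `rw` (adelic `−T` in the motive)
  (congrArg (fun g : ((ι → AdeleRing (𝓞 F) F) × (ι → AdeleRing (𝓞 F) F)) ≃ₗ[AdeleRing (𝓞 F) F]
      ((ι → AdeleRing (𝓞 F) F) × (ι → AdeleRing (𝓞 F) F)) => g (archVec F ι a, archVec F ι w))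
        (coe_proj_adelicMpContConj (s h))).trans (harch h a w)

/-- **(T4b-core, MODEL INSTANCE) `ω_f(conj ∘ s)(h) f = C (ω_f(s)(h) (C f))`**: the finite factor of the conjugate splitting
`s̄ := adelicMpContConj ∘ s : H →* Mp_ψ(W_{−T})ᶜᵒⁿᵗ` is the complex conjugate of the finite factor of `s` — the finite-adelic half of
«the Weil representation of the negated form is the conjugate Weil representation» ([Li1992, p. 181]; the non-archimedean content of
[Liu2021, Lem. D.1 (2)] `ω(μ,ε,χ)^∨ ≅ ω(μᶜ,−ε,χ⁻¹)` before passing to `χ`-coinvariants). [cite: Weil1964, Chap. III n° 37–38 p. 188–190]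
[cite: Li1992, p. 181] [cite: Liu2021, App. D Lemma D.1 (2) (FJcycle.tex l. 5231)] -/
theorem finRepMp_conj_apply (hT : IsUnit T) (s : H →* adelicMpCont F ι T)
    (harch : ∀ (h : H) (a w : ι → mixedSpace F),
      (adelicMpCont.proj F ι T (s h)).1 (archVec F ι a, archVec F ι w) = (archVec F ι a, archVec F ι w))
    (h : H) (f : FinSB F ι) :
    finRepMp hT.neg ((adelicMpContConj F ι T).toMonoidHom.comp s) (proj_adelicMpContConj_comp_apply_archVec s harch) h f =
      finSBConj (finRepMp hT s harch h (finSBConj f)) :=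
  finRepMp_eq_conj_of_omega_eq hT hT.neg s ((adelicMpContConj F ι T).toMonoidHom.comp s) harch
    (proj_adelicMpContConj_comp_apply_archVec s harch) id
    (fun h Ψ => adelicMpCont.omega_adelicMpContConj_apply (s h) Ψ) h f

/-- **semilinear-intertwiner form** (the shape of prove-7's (T4c) binders `hV ∕ hW`): `C (ω_f(s)(h) f) = ω_f(s̄)(h) (C f)`.
[cite: Weil1964, Chap. III n° 37–38 p. 188–190] [cite: Li1992, p. 181] -/
theorem finSBConj_finRepMp (hT : IsUnit T) (s : H →* adelicMpCont F ι T)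
    (harch : ∀ (h : H) (a w : ι → mixedSpace F),
      (adelicMpCont.proj F ι T (s h)).1 (archVec F ι a, archVec F ι w) = (archVec F ι a, archVec F ι w))
    (h : H) (f : FinSB F ι) :
    finSBConj (finRepMp hT s harch h f) =
      finRepMp hT.neg ((adelicMpContConj F ι T).toMonoidHom.comp s) (proj_adelicMpContConj_comp_apply_archVec s harch) h
        (finSBConj f) := by
  have h1 := finRepMp_conj_apply hT s harch h (finSBConj f)
  have h2 : finSBConj (finRepMp hT s harch h (finSBConj (finSBConj f))) = finSBConj (finRepMp hT s harch h f) := by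
    have hff : finSBConj (finSBConj f) = f := Subtype.ext (star_star _)
    rw [hff]
  exact (h1.trans h2).symm

end Summit.HodgeConjecture.CorCM.D2Bridge.AdapterWeil

end
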